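import Literature.Geometry.Manifold.ProperFunctionTube
import Mathlib.Analysis.SpecialFunctions.SmoothTransition
import Mathlib.Analysis.Calculus.Deriv.Slope
import HarnessLib

/-!
# Chaining overlapping necks into one tube, by a height function (metric-free)

General differential topology (topic `Geometry/Manifold`; everything PROVED, no definitions, no
named facts). A **neck** in a manifold `M` is here a smooth embedding `ψ : F × ℝ ↪ M` of the
cylinder over a compact manifold `F` with open range; its **height** is
`h_ψ = pr₂ ∘ ψ⁻¹ : ψ(F × ℝ) → ℝ`. R. Hamilton (*Four-manifolds with positive isotropic curvature*,
Comm. Anal. Geom. 5 (1997), §C2, p. 31: "we wish to combine two overlapping necks into one long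
one") and, in Perelman's language, B.-L. Chen and X.-P. Zhu (J. Differential Geom. 74 (2006), §5,
arXiv p. 24: "take any `ε`-neck … consider a point `x` on one of its boundary components … there is
either an `ε`-cap or an `ε`-neck, adjacent to the initial `ε`-neck. In the latter case we can take a
point on the boundary of the second `ε`-neck and continue. This procedure … producing an
`ε`-horn [/tube]") chain necks one after the other into tubes. What makes the union of two
overlapping necks again an embedded `F × ℝ` is a COMPATIBILITY of the two product structures in
the overlap; metrically it comes from both being close to the same round cylinder, but the
topological mechanism is metric-free and is isolated here, in the weakest form that works —
**monotone compatibility: the height of the old neck increases along the axial curves of the new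
neck, on a compact zone of the overlap** (no closeness of the transition map to an isometry is
needed; cf. Hirsch, *Differential Topology* (1976), Ch. 6 §2, Thm. 2.2, regular interval theorem,
for the recognition of the tube from a height function, which the tree has in the open form
`Literature.Geometry.Manifold.exists_isSmoothEmbedding_prod_real_range_eq_of_surjective_mfderiv`,
`ProperFunctionTube.lean`).

The chaining is organised as an induction whose state is a **height function** `g` on an open set
`U` (smooth, without critical points, proper on `U`) which on the top part `ψ(F × (t*, ∞))` of the
last neck is that neck's height up to a constant; one STEP absorbs a new neck `ψ'` whose bottom
`ψ'(F × (-∞, β₁])` lies in that top part, which meets `U` only inside that top part and only by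
an initial segment, and along whose axial curves the old height increases on the zone
`F × [β₀, β₁]`:

* `exists_heightFunction_extend` (**the step**): the new height function on `U ∪ ψ'(F × ℝ)` is
  `g' = Λ(h') (h + c) + (1 - Λ(h')) (h' + c')` on the new neck (`h, h'` the two heights, `Λ` a smooth
  cutoff of the new height, `= 1` below `β₀`, `= 0` above `(β₀ + β₁)/2`, `c'` so large that
  `h + c ≤ h' + c'` on the zone) and `g` elsewhere; it is smooth, proper, equal to `h' + c'` on the
  new top part `ψ'(F × (β₁, ∞))`, equal to `g` off `ψ'(F × [β₀, ∞))`, and has no critical points —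
  on the zone because its derivative along the axial curve `s ↦ ψ'(θ, s)` is
  `Λ' (h + c - s - c') + Λ ∂ₛh + (1 - Λ) > 0` (`Λ' ≤ 0`, `h + c - s - c' ≤ 0`, `∂ₛh > 0`).
* `isCompact_range_inter_height_preimage_Icc`, `contMDiffOn_height`, `surjective_mfderiv_height`
  (**the start**: one neck with its own height is such a state), and
* the FINISH is `exists_isSmoothEmbedding_prod_real_range_eq_of_surjective_mfderiv` of
  `ProperFunctionTube.lean` (with a slice of the first neck as level: the levels of the final
  height function in the untouched bottom of the first neck are its slices, and in the top part
  of the last neck the slices of the last neck), giving a smooth embedding `ι : F × ℝ ↪ M` onto the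
  union of the chain, level-preserving — so that prescribed slices of the first and of the last
  neck are slices `ι(F × {t})` (the form consumed by the collared neck pieces
  `Literature.Geometry.Riemannian.IsNeckPiece` of a surgically modified Ricci flow).

## References

* R. S. Hamilton, *Four-manifolds with positive isotropic curvature*, Comm. Anal. Geom. 5 (1997)
  1–92, §C2 (p. 31, combining overlapping necks). [Hamilton1997]
* B.-L. Chen, X.-P. Zhu, *Ricci flow with surgery on four-manifolds with positive isotropic
  curvature*, J. Differential Geom. 74 (2006) 177–264, §5 (arXiv:math/0504478, p. 24). [ChenZhu2006]
* M. W. Hirsch, *Differential Topology*, GTM 33 (1976), Ch. 6 §2, Thm. 2.2. [HirschDT1976]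
-/

open scoped Manifold ContDiff Topology
open Set Function Filter Metric Bundle Topology

noncomputable section

namespace Literature.Geometry.Manifold

universe u

/-! ### One-variable calculus of the blended height -/

section Calculus

/-- **The blended height increases along the new axis.** If `Λ` has derivative `Λ' ≤ 0` at `s`
with `0 ≤ Λ s ≤ 1`, `H` has derivative `H' > 0` at `s`, and `H s + c ≤ s + c'`, then
`s ↦ Λ s (H s + c) + (1 - Λ s)(s + c')` has a positive derivative at `s`, namely
`Λ' (H s + c - s - c') + Λ s H' + (1 - Λ s)`. [folklore] -/
theorem exists_pos_hasDerivAt_blend {Λ H : ℝ → ℝ} {s Λ' H' c c' : ℝ} (hΛ : HasDerivAt Λ Λ' s)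
    (hΛ' : Λ' ≤ 0) (hΛ0 : 0 ≤ Λ s) (hΛ1 : Λ s ≤ 1) (hH : HasDerivAt H H' s) (hH' : 0 < H')
    (hc : H s + c ≤ s + c') :
    ∃ d > 0, HasDerivAt (fun s ↦ Λ s * (H s + c) + (1 - Λ s) * (s + c')) d s := by
  refine ⟨Λ' * (H s + c) + Λ s * H' + (-Λ' * (s + c') + (1 - Λ s) * 1), ?_, ?_⟩
  · have h1 : 0 ≤ Λ' * (H s + c - s - c') := mul_nonneg_of_nonpos_of_nonpos hΛ' (by linarith)
    have h2 : 0 < Λ s * H' + (1 - Λ s) := by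
      rcases hΛ0.eq_or_lt with h | h
      · rw [← h]; norm_num
      · have := mul_pos h hH'
        linarith
    have key : Λ' * (H s + c) + Λ s * H' + (-Λ' * (s + c') + (1 - Λ s) * 1) =
        Λ' * (H s + c - s - c') + (Λ s * H' + (1 - Λ s)) := by ring
    rw [key]
    exact add_pos_of_nonneg_of_pos h1 h2
  · have hA : HasDerivAt (fun s ↦ Λ s * (H s + c)) (Λ' * (H s + c) + Λ s * H') s :=
      hΛ.mul (hH.add_const c)
    have hB : HasDerivAt (fun s ↦ (1 - Λ s) * (s + c')) (-Λ' * (s + c') + (1 - Λ s) * 1) s :=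
      (hΛ.const_sub 1).mul ((hasDerivAt_id s).add_const c')
    exact hA.add hB

/-- The cutoff of the step: `Λ(s) = smoothTransition ((βₘ - s)/(βₘ - β₀))` is smooth, equal to
`1` on `(-∞, β₀]`, to `0` on `[βₘ, ∞)`, takes values in `[0, 1]` and is non-increasing.
[folklore] -/
theorem cutoff_props {β₀ βm : ℝ} (h : β₀ < βm) :
    ContDiff ℝ ∞ (fun s ↦ Real.smoothTransition ((βm - s) / (βm - β₀))) ∧
    (∀ s ≤ β₀, Real.smoothTransition ((βm - s) / (βm - β₀)) = 1) ∧
    (∀ s, βm ≤ s → Real.smoothTransition ((βm - s) / (βm - β₀)) = 0) ∧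
    (∀ s, 0 ≤ Real.smoothTransition ((βm - s) / (βm - β₀)) ∧
      Real.smoothTransition ((βm - s) / (βm - β₀)) ≤ 1) ∧
    Antitone (fun s ↦ Real.smoothTransition ((βm - s) / (βm - β₀))) := by
  have hpos : 0 < βm - β₀ := sub_pos.2 h
  refine ⟨Real.smoothTransition.contDiff.comp ((contDiff_const.sub contDiff_id).div_const _),
    fun s hs ↦ Real.smoothTransition.one_of_one_le ?_,
    fun s hs ↦ Real.smoothTransition.zero_of_nonpos ?_,
    fun s ↦ ⟨Real.smoothTransition.nonneg _, Real.smoothTransition.le_one _⟩,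
    fun a b hab ↦ Real.smoothTransition.monotone ?_⟩
  · rw [le_div_iff₀ hpos]; linarith
  · exact div_nonpos_of_nonpos_of_nonneg (by linarith) hpos.le
  · exact div_le_div_of_nonneg_right (by linarith) hpos.le

end Calculus

/-! ### Real-valued maps on manifolds: critical points and curves -/

section RealMaps

variable {E : Type u} [NormedAddCommGroup E] [NormedSpace ℝ E]
  {H : Type*} [TopologicalSpace H] {I : ModelWithCorners ℝ E H}
  {M : Type*} [TopologicalSpace M] [ChartedSpace H M]

/-- A real-valued map whose differential at `y` is nonzero has onto differential at `y`.
[folklore] -/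
theorem surjective_mfderiv_of_ne_zero {f : M → ℝ} {y : M} (h : mfderiv I 𝓘(ℝ, ℝ) f y ≠ 0) :
    Surjective (mfderiv I 𝓘(ℝ, ℝ) f y) := by
  obtain ⟨v, hv⟩ : ∃ v, mfderiv I 𝓘(ℝ, ℝ) f y v ≠ 0 := by
    by_contra hc
    exact h (ContinuousLinearMap.ext fun v ↦ by simpa using not_exists.mp hc v)
  intro c
  change ℝ at c
  set a : ℝ := mfderiv I 𝓘(ℝ, ℝ) f y v with ha
  refine ⟨(c / a) • v, ?_⟩
  rw [map_smul]
  show c / a * a = c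
  exact div_mul_cancel₀ _ hv

/-- **A curve along which `f` has nonzero derivative passes through no critical point of `f`**:
if `f ∘ γ` has derivative `d ≠ 0` at `s` (with `f` differentiable at `γ s` and `γ` at `s`), then
`df_{γ s} ≠ 0` — by the chain rule `d = df_{γ s}(γ'(s))`. [folklore] -/
theorem mfderiv_ne_zero_of_hasDerivAt_comp [IsManifold I 1 M] {f : M → ℝ} {γ : ℝ → M} {s d : ℝ}
    (hf : MDifferentiableAt I 𝓘(ℝ, ℝ) f (γ s)) (hγ : MDifferentiableAt 𝓘(ℝ, ℝ) I γ s)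
    (h : HasDerivAt (f ∘ γ) d s) (hd : d ≠ 0) : mfderiv I 𝓘(ℝ, ℝ) f (γ s) ≠ 0 := by
  intro h0
  have hc := hf.hasMFDerivAt.comp s hγ.hasMFDerivAt
  rw [hasMFDerivAt_iff_hasFDerivAt] at hc
  have hc2 : HasFDerivAt (𝕜 := ℝ) (f ∘ γ)
      (show ℝ →L[ℝ] ℝ from (mfderiv I 𝓘(ℝ, ℝ) f (γ s)).comp (mfderiv 𝓘(ℝ, ℝ) I γ s)) s := hc
  have hc' := hc2.hasDerivAt
  have heq := h.unique hc'
  apply hd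
  rw [heq]
  show (mfderiv I 𝓘(ℝ, ℝ) f (γ s)) ((mfderiv 𝓘(ℝ, ℝ) I γ s) (1 : ℝ)) = 0
  rw [h0]
  rfl

end RealMaps

/-! ### Necks: heights of smooth open embeddings of a cylinder -/

section Neck

variable {E : Type u} [NormedAddCommGroup E] [NormedSpace ℝ E]
  {H : Type*} [TopologicalSpace H] {I : ModelWithCorners ℝ E H}
  {M : Type*} [TopologicalSpace M] [ChartedSpace H M]
  {EF : Type*} [NormedAddCommGroup EF] [NormedSpace ℝ EF] {HF : Type*} [TopologicalSpace HF]
  {IF : ModelWithCorners ℝ EF HF}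
  {F : Type*} [TopologicalSpace F] [ChartedSpace HF F] [IsManifold IF ∞ F] [Nonempty F]
  {ψ : F × ℝ → M}

omit [IsManifold IF ∞ F] in
/-- The inverse of a neck on its range. [folklore] -/
theorem invFun_apply_neck (hψ : Manifold.IsSmoothEmbedding (IF.prod 𝓘(ℝ, ℝ)) I ∞ ψ) (p : F × ℝ) :
    invFun ψ (ψ p) = p :=
  leftInverse_invFun hψ.isEmbedding.injective p

omit [IsManifold IF ∞ F] in
/-- The height of a neck at `ψ(θ, s)` is `s`. [folklore] -/
theorem height_apply_neck (hψ : Manifold.IsSmoothEmbedding (IF.prod 𝓘(ℝ, ℝ)) I ∞ ψ) (p : F × ℝ) :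
    (invFun ψ (ψ p)).2 = p.2 := by
  rw [invFun_apply_neck hψ]

omit [IsManifold IF ∞ F] in
/-- **The height of a neck is smooth on the neck** (the inverse of a smooth embedding is smooth
within its range, `contMDiffOn_invFun_range`). [folklore] -/
theorem contMDiffOn_height (hψ : Manifold.IsSmoothEmbedding (IF.prod 𝓘(ℝ, ℝ)) I ∞ ψ) :
    ContMDiffOn I 𝓘(ℝ, ℝ) ∞ (fun y ↦ (invFun ψ y).2) (range ψ) :=
  contMDiff_snd.comp_contMDiffOn (contMDiffOn_invFun_range hψ)

omit [IsManifold IF ∞ F] in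
/-- The `F`-coordinate of a neck is smooth on the neck. [folklore] -/
theorem contMDiffOn_base (hψ : Manifold.IsSmoothEmbedding (IF.prod 𝓘(ℝ, ℝ)) I ∞ ψ) :
    ContMDiffOn I IF ∞ (fun y ↦ (invFun ψ y).1) (range ψ) :=
  contMDiff_fst.comp_contMDiffOn (contMDiffOn_invFun_range hψ)

omit [IsManifold IF ∞ F] in
/-- **The height of a neck has no critical points on the neck** (`h ∘ ψ = pr₂`, so by the chain
rule `dh ∘ dψ = pr₂` is onto). [folklore] -/
theorem surjective_mfderiv_height (hψ : Manifold.IsSmoothEmbedding (IF.prod 𝓘(ℝ, ℝ)) I ∞ ψ)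
    (hψo : IsOpen (range ψ)) {y : M} (hy : y ∈ range ψ) :
    Surjective (mfderiv I 𝓘(ℝ, ℝ) (fun y ↦ (invFun ψ y).2) y) := by
  obtain ⟨p, rfl⟩ := hy
  set h : M → ℝ := fun y ↦ (invFun ψ y).2 with hh
  have hhd : MDifferentiableAt I 𝓘(ℝ, ℝ) h (ψ p) :=
    (((contMDiffOn_height hψ) _ ⟨p, rfl⟩).contMDiffAt (hψo.mem_nhds ⟨p, rfl⟩)).mdifferentiableAt
      (by simp)
  have hψd : MDifferentiableAt (IF.prod 𝓘(ℝ, ℝ)) I ψ p := (hψ.contMDiff p).mdifferentiableAt (by simp)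
  have hcomp : h ∘ ψ = Prod.snd := funext fun q ↦ height_apply_neck hψ q
  have hchain := mfderiv_comp p hhd hψd
  rw [hcomp, mfderiv_snd] at hchain
  intro c
  refine ⟨mfderiv (IF.prod 𝓘(ℝ, ℝ)) I ψ p ((0 : EF), (c : ℝ)), ?_⟩
  have := DFunLike.congr_fun hchain ((0 : EF), (c : ℝ))
  exact this.symm

omit [IsManifold IF ∞ F] [Nonempty F] in
/-- A neck is an open embedding; images of open sets are open. [folklore] -/
theorem isOpenMap_neck (hψ : Manifold.IsSmoothEmbedding (IF.prod 𝓘(ℝ, ℝ)) I ∞ ψ)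
    (hψo : IsOpen (range ψ)) : IsOpenMap ψ :=
  (⟨hψ.isEmbedding, hψo⟩ : IsOpenEmbedding ψ).isOpenMap

omit [IsManifold IF ∞ F] [Nonempty F] in
/-- **The start: one neck with its height is proper on itself** — `ψ(F × ℝ) ∩ h⁻¹[a, b] =
ψ(F × [a, b])` is compact (`F` compact). [folklore] -/
theorem range_inter_height_preimage_Icc [CompactSpace F]
    (hψ : Manifold.IsSmoothEmbedding (IF.prod 𝓘(ℝ, ℝ)) I ∞ ψ) [Nonempty F] (a b : ℝ) :
    range ψ ∩ (fun y ↦ (invFun ψ y).2) ⁻¹' Icc a b = ψ '' (univ ×ˢ Icc a b) := by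
  ext y
  constructor
  · rintro ⟨⟨p, rfl⟩, hp⟩
    rw [mem_preimage, height_apply_neck hψ] at hp
    exact ⟨p, ⟨mem_univ _, hp⟩, rfl⟩
  · rintro ⟨p, ⟨-, hp⟩, rfl⟩
    exact ⟨mem_range_self p, by rw [mem_preimage, height_apply_neck hψ]; exact hp⟩

omit [IsManifold IF ∞ F] [Nonempty F] in
/-- `ψ(F × [a, b])` is compact. [folklore] -/
theorem isCompact_image_neck_Icc [CompactSpace F]
    (hψ : Manifold.IsSmoothEmbedding (IF.prod 𝓘(ℝ, ℝ)) I ∞ ψ) (a b : ℝ) :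
    IsCompact (ψ '' (univ ×ˢ Icc a b)) :=
  (isCompact_univ.prod isCompact_Icc).image hψ.contMDiff.continuous

omit [IsManifold IF ∞ F] [Nonempty F] in
/-- The start: `ψ(F × ℝ) ∩ h⁻¹[a, b]` is compact. [folklore] -/
theorem isCompact_range_inter_height_preimage_Icc [CompactSpace F] [Nonempty F]
    (hψ : Manifold.IsSmoothEmbedding (IF.prod 𝓘(ℝ, ℝ)) I ∞ ψ) (a b : ℝ) :
    IsCompact (range ψ ∩ (fun y ↦ (invFun ψ y).2) ⁻¹' Icc a b) := by
  rw [range_inter_height_preimage_Icc hψ]; exact isCompact_image_neck_Icc hψ a b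

end Neck

/-! ### The step: absorbing one more neck into the height function -/

section Step

variable {E : Type u} [NormedAddCommGroup E] [NormedSpace ℝ E]
  {H : Type*} [TopologicalSpace H] {I : ModelWithCorners ℝ E H}
  {M : Type*} [TopologicalSpace M] [ChartedSpace H M] [IsManifold I ∞ M] [T2Space M]
  {EF : Type*} [NormedAddCommGroup EF] [NormedSpace ℝ EF] {HF : Type*} [TopologicalSpace HF]
  {IF : ModelWithCorners ℝ EF HF}
  {F : Type*} [TopologicalSpace F] [ChartedSpace HF F] [CompactSpace F] [Nonempty F]

/-- **The step of the chaining.** Let `g` be a height function on the open set `U` — smooth on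
`U`, without critical points on `U`, proper on `U` (`U ∩ g⁻¹[a, b]` compact) — which on the top
part `T = ψ(F × (t*, ∞)) ⊆ U` of a neck `ψ` equals that neck's height plus `c`. Let `ψ'` be a new
neck and `β₀ < β₁`, `β₂` numbers such that (i) the bottom `ψ'(F × (-∞, β₁])` lies in `T`; (ii) the
new neck meets `U` only inside `T` and only by an initial segment: `ψ'(F × ℝ) ∩ U ⊆ ψ'(F ×
(-∞, β₂)) ∩ T`; (iii) on the zone `F × [β₀, β₁]` the old height increases along the new axial
curves: `s ↦ h_ψ(ψ'(θ, s))` has a positive derivative. Then there are a height function `g'` on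
`U ∪ ψ'(F × ℝ)` — smooth, without critical points, proper — and a constant `c'` with
`g' = h_{ψ'} + c'` on the new top part `ψ'(F × (β₁, ∞))` and `g' = g` at the points of `U` off
`ψ'(F × [β₀, ∞))`. Construction and verification as in the module docstring (Hamilton 1997, §C2,
p. 31, "combine two overlapping necks into one long one"; Chen–Zhu 2006, §5, p. 24).
[cite: Hamilton1997, §3.2 (C2), p. 31] [cite: ChenZhu2006, §5, p. 24] [cite: HirschDT1976, Ch. 6 §2, Thm. 2.2] -/
theorem exists_heightFunction_extend (U : TopologicalSpace.Opens M)
    {g : M → ℝ} (hg : ContMDiffOn I 𝓘(ℝ, ℝ) ∞ g U)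
    (hdg : ∀ y ∈ U, Surjective (mfderiv I 𝓘(ℝ, ℝ) g y))
    (hK : ∀ a b : ℝ, IsCompact ((U : Set M) ∩ g ⁻¹' Icc a b))
    {ψ : F × ℝ → M} (hψ : Manifold.IsSmoothEmbedding (IF.prod 𝓘(ℝ, ℝ)) I ∞ ψ) {tstar c : ℝ}
    (hTU : ψ '' (univ ×ˢ Ioi tstar) ⊆ U)
    (hgT : ∀ p : F × ℝ, tstar < p.2 → g (ψ p) = p.2 + c)
    {ψ' : F × ℝ → M} (hψ' : Manifold.IsSmoothEmbedding (IF.prod 𝓘(ℝ, ℝ)) I ∞ ψ')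
    (hψ'o : IsOpen (range ψ')) {β₀ β₁ β₂ : ℝ} (hβ : β₀ < β₁)
    (hbot : ψ' '' (univ ×ˢ Iic β₁) ⊆ ψ '' (univ ×ˢ Ioi tstar))
    (hmeet : range ψ' ∩ U ⊆ ψ' '' (univ ×ˢ Iio β₂) ∩ ψ '' (univ ×ˢ Ioi tstar))
    (hmono : ∀ θ : F, ∀ s ∈ Icc β₀ β₁,
      ∃ d > 0, HasDerivAt (fun s : ℝ ↦ (invFun ψ (ψ' (θ, s))).2) d s) :
    ∃ (g' : M → ℝ) (c' : ℝ),
      ContMDiffOn I 𝓘(ℝ, ℝ) ∞ g' ((U : Set M) ∪ range ψ') ∧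
      (∀ y ∈ (U : Set M) ∪ range ψ', Surjective (mfderiv I 𝓘(ℝ, ℝ) g' y)) ∧
      (∀ a b : ℝ, IsCompact (((U : Set M) ∪ range ψ') ∩ g' ⁻¹' Icc a b)) ∧
      (∀ p : F × ℝ, β₁ < p.2 → g' (ψ' p) = p.2 + c') ∧
      (∀ y ∈ U, y ∉ ψ' '' (univ ×ˢ Ici β₀) → g' y = g y) := by
  classical
  -- notation: heights and the top part
  set h : M → ℝ := fun y ↦ (invFun ψ y).2 with hh
  set h' : M → ℝ := fun y ↦ (invFun ψ' y).2 with hh'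
  set T : Set M := ψ '' (univ ×ˢ Ioi tstar) with hT
  have hTψ : T ⊆ range ψ := image_subset_range _ _
  have hhψ : ∀ p, h (ψ p) = p.2 := fun p ↦ height_apply_neck hψ p
  have hh'ψ' : ∀ p, h' (ψ' p) = p.2 := fun p ↦ height_apply_neck hψ' p
  have hgT' : ∀ y ∈ T, g y = h y + c := by
    rintro _ ⟨p, ⟨-, hp⟩, rfl⟩
    rw [hgT p hp, hhψ]
  -- the cutoff
  set βm : ℝ := (β₀ + β₁) / 2 with hβm
  have hβ₀m : β₀ < βm := by rw [hβm]; linarith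
  have hβm₁ : βm < β₁ := by rw [hβm]; linarith
  set Λ : ℝ → ℝ := fun s ↦ Real.smoothTransition ((βm - s) / (βm - β₀)) with hΛ
  obtain ⟨hΛs, hΛ1, hΛ0, hΛ01, hΛanti⟩ : ContDiff ℝ ∞ Λ ∧ (∀ s ≤ β₀, Λ s = 1) ∧
      (∀ s, βm ≤ s → Λ s = 0) ∧ (∀ s, 0 ≤ Λ s ∧ Λ s ≤ 1) ∧ Antitone Λ :=
    cutoff_props hβ₀m
  -- the constant `c'`: `h(ψ' q) + c - q.2 ≤ c'` on the zone
  have hzoneT : ∀ q : F × ℝ, q.2 ≤ β₁ → ψ' q ∈ T := fun q hq ↦ hbot ⟨q, ⟨mem_univ _, hq⟩, rfl⟩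
  have hHc : ContinuousOn (fun q : F × ℝ ↦ h (ψ' q) - q.2) (univ ×ˢ Icc β₀ β₁) := by
    have h1 : ContinuousOn h (range ψ) := (contMDiffOn_height hψ).continuousOn
    have h2 : ContinuousOn (fun q : F × ℝ ↦ h (ψ' q)) (univ ×ˢ Icc β₀ β₁) :=
      h1.comp hψ'.contMDiff.continuous.continuousOn fun q hq ↦ hTψ (hzoneT q hq.2.2)
    exact h2.sub continuous_snd.continuousOn
  obtain ⟨B, hB⟩ := ((isCompact_univ.prod isCompact_Icc).image_of_continuousOn hHc).bddAbove
  set c' : ℝ := c + B with hc'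
  have hcc' : ∀ q : F × ℝ, q.2 ∈ Icc β₀ β₁ → h (ψ' q) + c ≤ q.2 + c' := by
    intro q hq
    have : h (ψ' q) - q.2 ≤ B := hB ⟨q, ⟨mem_univ _, hq⟩, rfl⟩
    rw [hc']; linarith
  -- the new height function
  set fA : M → ℝ := fun y ↦ Λ (h' y) * (h y + c) + (1 - Λ (h' y)) * (h' y + c') with hfA
  set g' : M → ℝ := fun y ↦ if y ∈ range ψ' then fA y else g y with hg'
  -- values
  have hg'ψ' : ∀ p, g' (ψ' p) = Λ p.2 * (h (ψ' p) + c) + (1 - Λ p.2) * (p.2 + c') := by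
    intro p
    simp only [hg', if_pos (mem_range_self p), hfA, hh'ψ']
  have hg'top : ∀ p : F × ℝ, β₁ < p.2 → g' (ψ' p) = p.2 + c' := by
    intro p hp
    rw [hg'ψ', hΛ0 p.2 (by linarith)]
    ring
  have hg'low : ∀ p : F × ℝ, p.2 ≤ β₀ → g' (ψ' p) = g (ψ' p) := by
    intro p hp
    rw [hg'ψ', hΛ1 p.2 hp, hgT' _ (hzoneT p (by linarith))]
    ring
  have hg'off : ∀ y, y ∉ range ψ' → g' y = g y := fun y hy ↦ by simp only [hg', if_neg hy]
  have hg'eq : ∀ y ∈ U, y ∉ ψ' '' (univ ×ˢ Ici β₀) → g' y = g y := by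
    intro y hyU hy
    by_cases hy' : y ∈ range ψ'
    · obtain ⟨p, rfl⟩ := hy'
      refine hg'low p (le_of_not_gt fun hp ↦ hy ⟨p, ⟨mem_univ _, hp.le⟩, rfl⟩)
    · exact hg'off y hy'
  -- the three open pieces
  set A : Set M := ψ' '' (univ ×ˢ Iio β₁) with hA
  set Bset : Set M := ψ' '' (univ ×ˢ Ioi βm) with hBset
  set S : Set M := ψ' '' (univ ×ˢ Ici β₀) with hS
  set D : Set M := (U : Set M) ∩ Sᶜ with hD
  have hAo : IsOpen A := isOpenMap_neck hψ' hψ'o _ (isOpen_univ.prod isOpen_Iio)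
  have hBo : IsOpen Bset := isOpenMap_neck hψ' hψ'o _ (isOpen_univ.prod isOpen_Ioi)
  have hAT : A ⊆ T := fun y hy ↦ by
    obtain ⟨p, ⟨-, hp⟩, rfl⟩ := hy
    exact hzoneT p (le_of_lt hp)
  -- `D` is open: no point of `U` is a limit of `S` from outside `S`
  have hSU : S ∩ U ⊆ ψ' '' (univ ×ˢ Icc β₀ β₂) := by
    rintro y ⟨⟨p, ⟨-, hp⟩, rfl⟩, hyU⟩
    obtain ⟨⟨q, ⟨-, hq⟩, hqp⟩, -⟩ := hmeet ⟨mem_range_self p, hyU⟩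
    obtain rfl : q = p := hψ'.isEmbedding.injective hqp
    exact ⟨q, ⟨mem_univ _, hp, hq.le⟩, rfl⟩
  have hDo : IsOpen D := by
    have hcl : (U : Set M) ∩ closure S ⊆ S := by
      intro z hz
      have h1 : z ∈ closure (S ∩ U) := by
        have := U.2.inter_closure (t := S) ⟨hz.1, hz.2⟩
        rwa [inter_comm] at this
      have h2 : closure (S ∩ U) ⊆ ψ' '' (univ ×ˢ Icc β₀ β₂) :=
        closure_minimal hSU (isCompact_image_neck_Icc hψ' β₀ β₂).isClosed
      obtain ⟨p, ⟨-, hp⟩, rfl⟩ := h2 h1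
      exact ⟨p, ⟨mem_univ _, hp.1⟩, rfl⟩
    have hDeq : D = (U : Set M) ∩ (closure S)ᶜ := by
      apply Subset.antisymm
      · rintro z ⟨hzU, hzS⟩
        exact ⟨hzU, fun hzc ↦ hzS (hcl ⟨hzU, hzc⟩)⟩
      · rintro z ⟨hzU, hzc⟩
        exact ⟨hzU, fun hzS ↦ hzc (subset_closure hzS)⟩
    rw [hDeq]
    exact U.2.inter isClosed_closure.isOpen_compl
  -- cover
  have hcover : (U : Set M) ∪ range ψ' ⊆ A ∪ Bset ∪ D := by
    intro y hy
    by_cases hy' : y ∈ range ψ'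
    · obtain ⟨p, rfl⟩ := hy'
      rcases lt_or_ge p.2 β₁ with hp | hp
      · exact Or.inl (Or.inl ⟨p, ⟨mem_univ _, hp⟩, rfl⟩)
      · exact Or.inl (Or.inr ⟨p, ⟨mem_univ _, lt_of_lt_of_le hβm₁ hp⟩, rfl⟩)
    · rcases hy with hyU | hyr
      · refine Or.inr ⟨hyU, fun hyS ↦ hy' ?_⟩
        obtain ⟨p, -, rfl⟩ := hyS
        exact mem_range_self p
      · exact absurd hyr hy'
  have hAsub : A ⊆ (U : Set M) ∪ range ψ' := fun y hy ↦ Or.inr (image_subset_range _ _ hy)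
  have hBsub : Bset ⊆ (U : Set M) ∪ range ψ' := fun y hy ↦ Or.inr (image_subset_range _ _ hy)
  have hDsub : D ⊆ (U : Set M) ∪ range ψ' := fun y hy ↦ Or.inl hy.1
  -- `g'` on the pieces
  have hg'A : EqOn g' fA A := fun y hy ↦ by
    obtain ⟨p, -, rfl⟩ := hy
    simp only [hg', if_pos (mem_range_self p)]
  have hg'B : EqOn g' (fun y ↦ h' y + c') Bset := fun y hy ↦ by
    obtain ⟨p, ⟨-, hp⟩, rfl⟩ := hy
    show g' (ψ' p) = h' (ψ' p) + c'
    rw [hg'ψ', hh'ψ', hΛ0 p.2 hp.le]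
    ring
  have hg'D : EqOn g' g D := fun y hy ↦ hg'eq y hy.1 hy.2
  -- smoothness on the pieces
  have hh's : ContMDiffOn I 𝓘(ℝ, ℝ) ∞ h' (range ψ') := contMDiffOn_height hψ'
  have hhs : ContMDiffOn I 𝓘(ℝ, ℝ) ∞ h (range ψ) := contMDiffOn_height hψ
  have hΛm : ContMDiff 𝓘(ℝ, ℝ) 𝓘(ℝ, ℝ) ∞ Λ := hΛs.contMDiff
  have hfAs : ContMDiffOn I 𝓘(ℝ, ℝ) ∞ fA A := by
    have h1 : ContMDiffOn I 𝓘(ℝ, ℝ) ∞ h' A := hh's.mono (image_subset_range _ _)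
    have h2 : ContMDiffOn I 𝓘(ℝ, ℝ) ∞ h A := hhs.mono (hAT.trans hTψ)
    have h3 : ContMDiffOn I 𝓘(ℝ, ℝ) ∞ (fun y ↦ Λ (h' y)) A := hΛm.comp_contMDiffOn h1
    have h4 : ContMDiffOn I 𝓘(ℝ, ℝ) ∞ (fun y ↦ Λ (h' y) * (h y + c)) A :=
      h3.mul (h2.add contMDiffOn_const)
    have h5 : ContMDiffOn I 𝓘(ℝ, ℝ) ∞ (fun y ↦ (1 - Λ (h' y)) * (h' y + c')) A :=
      (contMDiffOn_const.sub h3).mul (h1.add contMDiffOn_const)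
    exact h4.add h5
  have hfBs : ContMDiffOn I 𝓘(ℝ, ℝ) ∞ (fun y ↦ h' y + c') Bset :=
    (hh's.mono (image_subset_range _ _)).add contMDiffOn_const
  have hg'sA : ContMDiffOn I 𝓘(ℝ, ℝ) ∞ g' A := hfAs.congr hg'A
  have hg'sB : ContMDiffOn I 𝓘(ℝ, ℝ) ∞ g' Bset := hfBs.congr hg'B
  have hg'sD : ContMDiffOn I 𝓘(ℝ, ℝ) ∞ g' D := (hg.mono inter_subset_left).congr hg'D
  have hg's : ContMDiffOn I 𝓘(ℝ, ℝ) ∞ g' ((U : Set M) ∪ range ψ') := by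
    intro y hy
    rcases hcover hy with (hyA | hyB) | hyD
    · exact ((hg'sA y hyA).contMDiffAt (hAo.mem_nhds hyA)).contMDiffWithinAt
    · exact ((hg'sB y hyB).contMDiffAt (hBo.mem_nhds hyB)).contMDiffWithinAt
    · exact ((hg'sD y hyD).contMDiffAt (hDo.mem_nhds hyD)).contMDiffWithinAt
  have hUo' : IsOpen ((U : Set M) ∪ range ψ') := U.2.union hψ'o
  have hg'd : ∀ y ∈ (U : Set M) ∪ range ψ', MDifferentiableAt I 𝓘(ℝ, ℝ) g' y := fun y hy ↦
    ((hg's y hy).contMDiffAt (hUo'.mem_nhds hy)).mdifferentiableAt (by simp)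
  -- no critical points
  have hcrit : ∀ y ∈ (U : Set M) ∪ range ψ', Surjective (mfderiv I 𝓘(ℝ, ℝ) g' y) := by
    intro y hy
    -- points of `D`: `g' = g` nearby
    have caseD : y ∈ D → Surjective (mfderiv I 𝓘(ℝ, ℝ) g' y) := fun hyD ↦ by
      have hev : g' =ᶠ[𝓝 y] g := Filter.eventuallyEq_of_mem (hDo.mem_nhds hyD) hg'D
      rw [hev.mfderiv_eq]
      exact hdg y hyD.1
    by_cases hyD : y ∈ D
    · exact caseD hyD
    -- otherwise `y = ψ'(θ, s₀)` with `β₀ ≤ s₀`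
    have hy' : y ∈ S := by
      by_contra hyS
      rcases hy with hyU | hyr
      · exact hyD ⟨hyU, hyS⟩
      · obtain ⟨p, rfl⟩ := hyr
        have hp : p.2 < β₀ := lt_of_not_ge fun hp ↦ hyS ⟨p, ⟨mem_univ _, hp⟩, rfl⟩
        exact hyD ⟨hTU (hzoneT p (by linarith)), hyS⟩
    obtain ⟨⟨θ, s₀⟩, ⟨-, hs₀ : β₀ ≤ s₀⟩, rfl⟩ := hy'
    apply surjective_mfderiv_of_ne_zero
    -- the axial curve
    set γ : ℝ → M := fun s ↦ ψ' (θ, s) with hγ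
    have hγd : MDifferentiableAt 𝓘(ℝ, ℝ) I γ s₀ :=
      ((hψ'.contMDiff.comp (contMDiff_const.prodMk contMDiff_id)) s₀).mdifferentiableAt (by simp)
    have hcompφ : g' ∘ γ = fun s ↦ Λ s * (h (ψ' (θ, s)) + c) + (1 - Λ s) * (s + c') :=
      funext fun s ↦ hg'ψ' (θ, s)
    show mfderiv I 𝓘(ℝ, ℝ) g' (γ s₀) ≠ 0
    rcases lt_or_ge s₀ β₁ with hs₁ | hs₁
    · -- the zone `β₀ ≤ s₀ < β₁`
      obtain ⟨d, hd, hHd⟩ := hmono θ s₀ ⟨hs₀, hs₁.le⟩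
      have hΛd : HasDerivAt Λ (deriv Λ s₀) s₀ :=
        ((hΛs.differentiable (by simp)) s₀).hasDerivAt
      obtain ⟨d', hd', hφ⟩ := exists_pos_hasDerivAt_blend (c := c) (c' := c') hΛd
        (hΛd.nonpos_of_antitone hΛanti) (hΛ01 s₀).1 (hΛ01 s₀).2 hHd hd (hcc' (θ, s₀) ⟨hs₀, hs₁.le⟩)
      refine mfderiv_ne_zero_of_hasDerivAt_comp (hg'd _ hy) hγd ?_ hd'.ne'
      rw [hcompφ]; exact hφ
    · -- above the zone: `g' ∘ γ = s + c'` near `s₀`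
      have hev : (fun s : ℝ ↦ s + c') =ᶠ[𝓝 s₀] g' ∘ γ := by
        have : ∀ᶠ s in 𝓝 s₀, βm < s := lt_mem_nhds (lt_of_lt_of_le hβm₁ hs₁)
        filter_upwards [this] with s hs
        rw [hcompφ]
        show s + c' = Λ s * (h (ψ' (θ, s)) + c) + (1 - Λ s) * (s + c')
        rw [hΛ0 s hs.le]
        ring
      have hφ : HasDerivAt (g' ∘ γ) 1 s₀ := ((hasDerivAt_id s₀).add_const c').congr_of_eventuallyEq hev.symm
      exact mfderiv_ne_zero_of_hasDerivAt_comp (hg'd _ hy) hγd hφ one_ne_zero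
  -- properness
  have hprop : ∀ a b : ℝ, IsCompact (((U : Set M) ∪ range ψ') ∩ g' ⁻¹' Icc a b) := by
    intro a b
    set K : Set M := ((U : Set M) ∩ g ⁻¹' Icc a b) ∪ ψ' '' (univ ×ˢ Icc β₀ (max β₁ (b - c')))
      with hKdef
    have hKc : IsCompact K := (hK a b).union (isCompact_image_neck_Icc hψ' _ _)
    have hKsub : K ⊆ (U : Set M) ∪ range ψ' :=
      union_subset_union inter_subset_left (image_subset_range _ _)
    have hsub : ((U : Set M) ∪ range ψ') ∩ g' ⁻¹' Icc a b ⊆ K := by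
      rintro y ⟨hy, hgy⟩
      rw [mem_preimage] at hgy
      by_cases hy' : y ∈ range ψ'
      · obtain ⟨p, rfl⟩ := hy'
        rcases lt_or_ge p.2 β₀ with hp | hp
        · refine Or.inl ⟨hTU (hzoneT p (by linarith)), ?_⟩
          rw [mem_preimage, ← hg'low p hp.le]; exact hgy
        · refine Or.inr ⟨p, ⟨mem_univ _, hp, ?_⟩, rfl⟩
          rcases le_or_gt p.2 β₁ with hp1 | hp1
          · exact hp1.trans (le_max_left _ _)
          · rw [hg'top p hp1] at hgy
            exact le_trans (by linarith [hgy.2]) (le_max_right _ _)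
      · rcases hy with hyU | hyr
        · refine Or.inl ⟨hyU, ?_⟩
          rw [mem_preimage, ← hg'off y hy']; exact hgy
        · exact absurd hyr hy'
    have heq : ((U : Set M) ∪ range ψ') ∩ g' ⁻¹' Icc a b = K ∩ g' ⁻¹' Icc a b := by
      apply Subset.antisymm
      · exact fun y hy ↦ ⟨hsub hy, hy.2⟩
      · exact fun y hy ↦ ⟨hKsub hy.1, hy.2⟩
    rw [heq]
    exact hKc.of_isClosed_subset
      ((hg's.continuousOn.mono hKsub).preimage_isClosed_of_isClosed hKc.isClosed isClosed_Icc)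
      inter_subset_left
  exact ⟨g', c', hg's, hcrit, hprop, hg'top, hg'eq⟩

end Step

/-! ### The finish: the tube, with prescribed slices, from the final height function -/

section Finish

variable {E : Type u} [NormedAddCommGroup E] [NormedSpace ℝ E] [FiniteDimensional ℝ E]
  {H : Type*} [TopologicalSpace H] {I : ModelWithCorners ℝ E H} [I.Boundaryless]
  {M : Type*} [TopologicalSpace M] [ChartedSpace H M] [IsManifold I ∞ M] [T2Space M]
  [SecondCountableTopology M]
  {EF : Type*} [NormedAddCommGroup EF] [NormedSpace ℝ EF] {HF : Type*} [TopologicalSpace HF]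
  {IF : ModelWithCorners ℝ EF HF} [IF.Boundaryless]
  {F : Type*} [TopologicalSpace F] [ChartedSpace HF F] [IsManifold IF ∞ F]

/-- **Tubes from a height function without critical points, the level given with a smooth left
inverse** (variant of `exists_isSmoothEmbedding_prod_real_range_eq_of_surjective_mfderiv` of
`ProperFunctionTube.lean` in which the parametrised level `σ : F → M` is only asked to be smooth
with a left inverse `ρ` smooth within `range σ` — the form available for a slice
`θ ↦ ψ(θ, t₀)` of a neck, `ρ = pr₁ ∘ ψ⁻¹`). Hirsch (1976), Ch. 6 §2, Thm. 2.2.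
[cite: HirschDT1976, Ch. 6 §2, Thm. 2.2 (PDF p. 144)] -/
theorem exists_isSmoothEmbedding_prod_real_range_eq_of_leftInverse
    (U : TopologicalSpace.Opens M)
    {g : M → ℝ} (hg : ContMDiffOn I 𝓘(ℝ, ℝ) ∞ g U)
    (hdg : ∀ x ∈ U, Surjective (mfderiv I 𝓘(ℝ, ℝ) g x))
    (hK : ∀ a b : ℝ, IsCompact ((U : Set M) ∩ g ⁻¹' Icc a b))
    {σ : F → M} (hσ : ContMDiff IF I ∞ σ) {ρ : M → F} (hρ : ContMDiffOn I IF ∞ ρ (range σ))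
    (hρσ : ∀ θ, ρ (σ θ) = θ) (L : (EF × ℝ) ≃L[ℝ] E)
    {s₀ : ℝ} (hσg : range σ = (U : Set M) ∩ g ⁻¹' {s₀}) :
    ∃ ι : F × ℝ → M, Manifold.IsSmoothEmbedding (IF.prod 𝓘(ℝ, ℝ)) I ∞ ι ∧
      range ι = U ∧ (∀ θ, ι (θ, 0) = σ θ) ∧ ∀ p, g (ι p) = s₀ + p.2 := by
  classical
  haveI : LocallyCompactSpace M := Manifold.locallyCompact_of_finiteDimensional I
  haveI : LocallyCompactSpace U := U.2.locallyCompactSpace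
  have hσU : range σ ⊆ U := hσg ▸ inter_subset_left
  set g' : U → ℝ := fun x ↦ g x.1 with hg'
  have hg's : ContMDiff I 𝓘(ℝ, ℝ) ∞ g' := hg.comp_contMDiff contMDiff_subtype_val fun x ↦ x.2
  have hdg' : ∀ x : U, Surjective (mfderiv I 𝓘(ℝ, ℝ) g' x) := by
    intro x
    have hgd : MDifferentiableAt I 𝓘(ℝ, ℝ) g x.1 :=
      ((hg x.1 x.2).contMDiffAt (U.2.mem_nhds x.2)).mdifferentiableAt (by simp)
    have hchain : mfderiv I 𝓘(ℝ, ℝ) (g ∘ (Subtype.val : U → M)) x =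
        (mfderiv I 𝓘(ℝ, ℝ) g x.1).comp (mfderiv I I (Subtype.val : U → M) x) :=
      mfderiv_comp x hgd (OpenSubmanifold.mdifferentiableAt_subtype_val x)
    have : g' = g ∘ (Subtype.val : U → M) := rfl
    rw [this, hchain, OpenSubmanifold.mfderiv_subtype_val]
    exact fun c ↦ hdg x.1 x.2 c
  have hK' : ∀ a b : ℝ, IsCompact (g' ⁻¹' Icc a b) := fun a b ↦ by
    have : g' ⁻¹' Icc a b = (Subtype.val : U → M) ⁻¹' ((U : Set M) ∩ g ⁻¹' Icc a b) := by
      ext x; simp [hg']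
    rw [this]
    exact isCompact_preimage_val_of_subset (hK a b) inter_subset_left
  obtain ⟨V', hV's, hgV'⟩ := exists_contMDiff_lift_of_surjective_mfderiv hg's hdg' (1 : ℝ)
  set σ' : F → U := fun θ ↦ ⟨σ θ, hσU (mem_range_self θ)⟩ with hσ'
  have hσ's : ContMDiff IF I ∞ σ' := by
    rw [← ContMDiff.subtypeVal_comp_iff U σ']
    exact hσ
  have hσ'g : range σ' = g' ⁻¹' {s₀} := by
    ext x
    constructor
    · rintro ⟨θ, rfl⟩
      have : σ θ ∈ (U : Set M) ∩ g ⁻¹' {s₀} := hσg ▸ mem_range_self θ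
      exact this.2
    · intro hx
      have : x.1 ∈ range σ := by rw [hσg]; exact ⟨x.2, hx⟩
      obtain ⟨θ, hθ⟩ := this
      exact ⟨θ, Subtype.ext hθ⟩
  rcases isEmpty_or_nonempty F with hF | hF
  · have hUe : IsEmpty U := by
      by_contra h
      rw [not_isEmpty_iff] at h
      obtain ⟨y⟩ := h
      obtain ⟨φ, -, -, -, -, hφg⟩ := exists_globalFlow_of_lift (c := (1 : ℝ)) hg's hV's hgV'
        (isCompact_preimage_closedBall_of_Icc hK')
      have : φ (s₀ - g' y, y) ∈ range σ' := by
        rw [hσ'g, mem_preimage, mem_singleton_iff, hφg]; simp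
      obtain ⟨θ, -⟩ := this
      exact hF.elim θ
    haveI : IsEmpty (F × ℝ) := by infer_instance
    refine ⟨fun p ↦ isEmptyElim p, ?_, ?_, fun θ ↦ isEmptyElim θ, fun p ↦ isEmptyElim p⟩
    · exact ⟨Manifold.IsImmersionOfComplement.isImmersion (F := Unit) fun x ↦ isEmptyElim x,
        Topology.IsEmbedding.of_subsingleton _⟩
    · rw [range_eq_empty, eq_comm, ← Set.not_nonempty_iff_eq_empty]
      rintro ⟨y, hy⟩
      exact hUe.elim ⟨y, hy⟩
  set ρ' : U → F := fun x ↦ ρ x.1 with hρ'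
  have hρ's : ContMDiffOn I IF ∞ ρ' (range σ') := by
    have hmaps : MapsTo (Subtype.val : U → M) (range σ') (range σ) := by
      rintro _ ⟨θ, rfl⟩; exact mem_range_self θ
    exact hρ.comp contMDiff_subtype_val.contMDiffOn hmaps
  have hρσ' : ∀ θ, ρ' (σ' θ) = θ := fun θ ↦ hρσ θ
  obtain ⟨Φ, hΦ0, hΦg⟩ := exists_diffeomorph_prod_real_of_leftInverse (I := I) (M := U)
    hg's hV's hgV' hK' hσ's hρ's hρσ' hσ'g
  obtain ⟨hemb, hrange⟩ := isSmoothEmbedding_subtypeVal_comp_diffeomorph U Φ L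
  refine ⟨Subtype.val ∘ Φ, hemb, hrange, fun θ ↦ ?_, fun p ↦ ?_⟩
  · show (Φ (θ, 0)).1 = σ θ
    rw [hΦ0]
  · show g (Φ p).1 = s₀ + p.2
    exact hΦg p

/-- **Identification of a level inside an open set, from the absence of critical points** (the
field-free form of `range_eq_inter_preimage_singleton_of_isPreconnected`: the translating field
is lifted on the open submanifold `U`). On a connected open `U` on which `g` is smooth, proper
and without critical points, a compact nonempty `σ(F) ⊆ U` with `g ∘ σ = s₀`, open in the level
(`W ∩ g⁻¹(s₀) ⊆ σ(F) ⊆ W`, `W ⊆ U` open), is the whole level `U ∩ g⁻¹(s₀)`.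
[cite: HirschDT1976, Ch. 6 §2, Thm. 2.2 (proof, PDF p. 144)] -/
theorem range_eq_inter_preimage_singleton_of_surjective_mfderiv [CompactSpace F] [Nonempty F]
    (U : TopologicalSpace.Opens M) (hU : IsPreconnected (U : Set M))
    {g : M → ℝ} (hg : ContMDiffOn I 𝓘(ℝ, ℝ) ∞ g U)
    (hdg : ∀ x ∈ U, Surjective (mfderiv I 𝓘(ℝ, ℝ) g x))
    (hK : ∀ a b : ℝ, IsCompact ((U : Set M) ∩ g ⁻¹' Icc a b))
    {σ : F → M} (hσ : Continuous σ) {s₀ : ℝ} (hσs : ∀ θ, g (σ θ) = s₀)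
    {W : Set M} (hW : IsOpen W) (hWU : W ⊆ U) (hWσ : W ∩ g ⁻¹' {s₀} ⊆ range σ)
    (hσW : range σ ⊆ W) :
    range σ = (U : Set M) ∩ g ⁻¹' {s₀} := by
  haveI : LocallyCompactSpace M := Manifold.locallyCompact_of_finiteDimensional I
  haveI : LocallyCompactSpace U := U.2.locallyCompactSpace
  haveI : PreconnectedSpace U := isPreconnected_iff_preconnectedSpace.1 hU
  have hσU : range σ ⊆ U := hσW.trans hWU
  set g' : U → ℝ := fun x ↦ g x.1 with hg'
  have hg's : ContMDiff I 𝓘(ℝ, ℝ) ∞ g' := hg.comp_contMDiff contMDiff_subtype_val fun x ↦ x.2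
  have hdg' : ∀ x : U, Surjective (mfderiv I 𝓘(ℝ, ℝ) g' x) := by
    intro x
    have hgd : MDifferentiableAt I 𝓘(ℝ, ℝ) g x.1 :=
      ((hg x.1 x.2).contMDiffAt (U.2.mem_nhds x.2)).mdifferentiableAt (by simp)
    have hchain : mfderiv I 𝓘(ℝ, ℝ) (g ∘ (Subtype.val : U → M)) x =
        (mfderiv I 𝓘(ℝ, ℝ) g x.1).comp (mfderiv I I (Subtype.val : U → M) x) :=
      mfderiv_comp x hgd (OpenSubmanifold.mdifferentiableAt_subtype_val x)
    have : g' = g ∘ (Subtype.val : U → M) := rfl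
    rw [this, hchain, OpenSubmanifold.mfderiv_subtype_val]
    exact fun c ↦ hdg x.1 x.2 c
  have hK' : ∀ a b : ℝ, IsCompact (g' ⁻¹' Icc a b) := fun a b ↦ by
    have : g' ⁻¹' Icc a b = (Subtype.val : U → M) ⁻¹' ((U : Set M) ∩ g ⁻¹' Icc a b) := by
      ext x; simp [hg']
    rw [this]
    exact isCompact_preimage_val_of_subset (hK a b) inter_subset_left
  obtain ⟨V', hV's, hgV'⟩ := exists_contMDiff_lift_of_surjective_mfderiv hg's hdg' (1 : ℝ)
  set σ' : F → U := fun θ ↦ ⟨σ θ, hσU (mem_range_self θ)⟩ with hσ'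
  have hσ'c : Continuous σ' := hσ.subtype_mk _
  set W' : Set U := (Subtype.val : U → M) ⁻¹' W with hW'
  have hW'o : IsOpen W' := hW.preimage continuous_subtype_val
  have key := range_eq_preimage_singleton_of_isPreconnected (I := I) (M := U) hg's hV's hgV' hK'
    hσ'c (s₀ := s₀) (fun θ ↦ hσs θ) hW'o (by
      rintro x ⟨hxW, hxg⟩
      obtain ⟨θ, hθ⟩ := hWσ ⟨hxW, hxg⟩
      exact ⟨θ, Subtype.ext hθ⟩) (by
      rintro _ ⟨θ, rfl⟩
      exact hσW (mem_range_self θ))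
  apply Subset.antisymm
  · rintro _ ⟨θ, rfl⟩; exact ⟨hσU (mem_range_self θ), hσs θ⟩
  · rintro y ⟨hyU, hyg⟩
    have : (⟨y, hyU⟩ : U) ∈ range σ' := by rw [key]; exact hyg
    obtain ⟨θ, hθ⟩ := this
    exact ⟨θ, congrArg Subtype.val hθ⟩

omit [TopologicalSpace M] [T2Space M] [SecondCountableTopology M] [TopologicalSpace F] in
/-- The range of a slice `θ ↦ ψ(θ, s)` of a neck. [folklore] -/
theorem range_slice_eq_image (ψ : F × ℝ → M) (s : ℝ) :
    range (fun θ : F ↦ ψ (θ, s)) = ψ '' (univ ×ˢ {s}) := by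
  ext y
  constructor
  · rintro ⟨θ, rfl⟩; exact ⟨(θ, s), ⟨mem_univ _, rfl⟩, rfl⟩
  · rintro ⟨⟨θ, s'⟩, ⟨-, rfl : s' = s⟩, rfl⟩; exact ⟨θ, rfl⟩

omit [IF.Boundaryless] [IsManifold IF ∞ F] in
/-- **Where the height function is a neck's height, its levels are that neck's slices.** If on
the open part `ψ(F × J)` (`J ⊆ ℝ` open) of a neck lying in the connected open `U` the height
function `g` (smooth, proper, without critical points on `U`) equals `h_ψ + c`, then for `s ∈ J`
the slice `ψ(F × {s})` is the whole level `U ∩ g⁻¹(s + c)`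
(`range_eq_inter_preimage_singleton_of_surjective_mfderiv` with the band `W = ψ(F × J)`).
[cite: HirschDT1976, Ch. 6 §2, Thm. 2.2 (proof, PDF p. 144)] -/
theorem image_slice_eq_inter_preimage [CompactSpace F] [Nonempty F]
    (U : TopologicalSpace.Opens M) (hU : IsPreconnected (U : Set M))
    {g : M → ℝ} (hg : ContMDiffOn I 𝓘(ℝ, ℝ) ∞ g U)
    (hdg : ∀ x ∈ U, Surjective (mfderiv I 𝓘(ℝ, ℝ) g x))
    (hK : ∀ a b : ℝ, IsCompact ((U : Set M) ∩ g ⁻¹' Icc a b))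
    {ψ : F × ℝ → M} (hψ : Manifold.IsSmoothEmbedding (IF.prod 𝓘(ℝ, ℝ)) I ∞ ψ)
    (hψo : IsOpen (range ψ)) {J : Set ℝ} (hJ : IsOpen J) {c : ℝ}
    (hJU : ψ '' (univ ×ˢ J) ⊆ U) (hgJ : ∀ p : F × ℝ, p.2 ∈ J → g (ψ p) = p.2 + c)
    {s : ℝ} (hs : s ∈ J) :
    ψ '' (univ ×ˢ {s}) = (U : Set M) ∩ g ⁻¹' {s + c} := by
  rw [← range_slice_eq_image]
  refine range_eq_inter_preimage_singleton_of_surjective_mfderiv U hU hg hdg hK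
    (hψ.contMDiff.continuous.comp (continuous_id.prodMk continuous_const))
    (fun θ ↦ hgJ (θ, s) hs) (isOpenMap_neck hψ hψo _ (isOpen_univ.prod hJ)) hJU ?_ ?_
  · rintro y ⟨⟨p, ⟨-, hp⟩, rfl⟩, hgy⟩
    have h1 : g (ψ p) = p.2 + c := hgJ p hp
    have h2 : g (ψ p) = s + c := hgy
    have hps : p.2 = s := by linarith
    refine ⟨p.1, ?_⟩
    show ψ (p.1, s) = ψ p
    simp only [← hps, Prod.mk.eta]
  · rintro _ ⟨θ, rfl⟩
    exact ⟨(θ, s), ⟨mem_univ _, hs⟩, rfl⟩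

/-- **The finish of the chaining: the tube with prescribed slices.** Let `g` be a height
function on the connected open `U` (smooth, proper, without critical points on `U`) which on the
bottom part `ψ₁(F × (-∞, t₁)) ⊆ U` of a neck `ψ₁` equals `h_{ψ₁} + c₁` (`F` compact nonempty over
a boundaryless model, `L : E_F × ℝ ≃ E`). Then there are a smooth embedding `ι : F × ℝ ↪ M` onto
`U` and a constant `e` with `g ∘ ι = pr₂ + e`; consequently every level of `g` in `U` is a slice
of `ι`, `ι(F × {t}) = U ∩ g⁻¹(t + e)` — and by `image_slice_eq_inter_preimage` the slices of `ι`
in the bottom part of `ψ₁` (resp. in the top part of the last neck of a chain) are slices of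
`ψ₁` (resp. of the last neck). The level used is the slice `ψ₁(F × {t₁ - 1})`, whose left inverse
`pr₁ ∘ ψ₁⁻¹` is smooth on the neck (`exists_isSmoothEmbedding_prod_real_range_eq_of_leftInverse`).
Hirsch (1976), Ch. 6 §2, Thm. 2.2; Hamilton (1997), §C2; Chen–Zhu (2006), §5, p. 24.
[cite: HirschDT1976, Ch. 6 §2, Thm. 2.2 (PDF p. 144)] [cite: Hamilton1997, §3.2 (C2), p. 31] -/
theorem exists_isSmoothEmbedding_of_heightFunction [CompactSpace F] [Nonempty F]
    (U : TopologicalSpace.Opens M) (hU : IsPreconnected (U : Set M))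
    {g : M → ℝ} (hg : ContMDiffOn I 𝓘(ℝ, ℝ) ∞ g U)
    (hdg : ∀ x ∈ U, Surjective (mfderiv I 𝓘(ℝ, ℝ) g x))
    (hK : ∀ a b : ℝ, IsCompact ((U : Set M) ∩ g ⁻¹' Icc a b))
    {ψ₁ : F × ℝ → M} (hψ₁ : Manifold.IsSmoothEmbedding (IF.prod 𝓘(ℝ, ℝ)) I ∞ ψ₁)
    (hψ₁o : IsOpen (range ψ₁)) {t₁ c₁ : ℝ}
    (hBU : ψ₁ '' (univ ×ˢ Iio t₁) ⊆ U) (hgB : ∀ p : F × ℝ, p.2 < t₁ → g (ψ₁ p) = p.2 + c₁)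
    (L : (EF × ℝ) ≃L[ℝ] E) :
    ∃ (ι : F × ℝ → M) (e : ℝ), Manifold.IsSmoothEmbedding (IF.prod 𝓘(ℝ, ℝ)) I ∞ ι ∧
      range ι = U ∧ (∀ p, g (ι p) = p.2 + e) ∧
      ∀ t : ℝ, ι '' (univ ×ˢ {t}) = (U : Set M) ∩ g ⁻¹' {t + e} := by
  set t₀ : ℝ := t₁ - 1 with ht₀
  have ht₀₁ : t₀ < t₁ := by rw [ht₀]; linarith
  set σ : F → M := fun θ ↦ ψ₁ (θ, t₀) with hσ
  have hσs : ContMDiff IF I ∞ σ := hψ₁.contMDiff.comp (contMDiff_id.prodMk contMDiff_const)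
  have hσψ : range σ ⊆ range ψ₁ := by rintro _ ⟨θ, rfl⟩; exact mem_range_self _
  set ρ : M → F := fun y ↦ (invFun ψ₁ y).1 with hρ
  have hρs : ContMDiffOn I IF ∞ ρ (range σ) := (contMDiffOn_base hψ₁).mono hσψ
  have hρσ : ∀ θ, ρ (σ θ) = θ := fun θ ↦ by
    show (invFun ψ₁ (ψ₁ (θ, t₀))).1 = θ
    rw [invFun_apply_neck hψ₁]
  have hlevel : range σ = (U : Set M) ∩ g ⁻¹' {t₀ + c₁} := by
    rw [hσ, range_slice_eq_image]
    exact image_slice_eq_inter_preimage U hU hg hdg hK hψ₁ hψ₁o isOpen_Iio hBU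
      (fun p hp ↦ hgB p hp) ht₀₁
  obtain ⟨ι, hι, hrange, -, hgι⟩ :=
    exists_isSmoothEmbedding_prod_real_range_eq_of_leftInverse U hg hdg hK hσs hρs hρσ L hlevel
  refine ⟨ι, t₀ + c₁, hι, hrange, fun p ↦ by rw [hgι]; ring, fun t ↦ ?_⟩
  apply Subset.antisymm
  · rintro _ ⟨⟨θ, t'⟩, ⟨-, rfl : t' = t⟩, rfl⟩
    refine ⟨hrange ▸ mem_range_self _, ?_⟩
    show g (ι (θ, t')) ∈ ({t' + (t₀ + c₁)} : Set ℝ)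
    rw [mem_singleton_iff, hgι]; ring
  · rintro y ⟨hyU, hgy⟩
    rw [← hrange] at hyU
    obtain ⟨⟨θ, t'⟩, rfl⟩ := hyU
    have h1 : g (ι (θ, t')) = t₀ + c₁ + t' := hgι _
    have h2 : g (ι (θ, t')) = t + (t₀ + c₁) := hgy
    have : t' = t := by linarith
    exact ⟨(θ, t'), ⟨mem_univ _, this⟩, rfl⟩

end Finish

end Literature.Geometry.Manifold

end
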